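import Summits.HodgeConjecture.HodgeConjecture.Theorems.H413SpectrumJunction
import Summits.HodgeConjecture.HodgeConjecture.Theorems.H413CohFormsCarriers
import HarnessLib

/-!
# FLOOR-0 junction T7 AT THE PIN `U(V)`: the crux carriers read in the honest `L²` spectrum (J1 / J2 / J3, pin part)

Cell hodgecm-mathlib, FLOOR 0; crux item H413 = stmt-HodgeConjecture-24833 (route `HCCMUnconditional`); prover F0P3-p04 (g0),
share «junction T7 support» (JOIN BRIEF of line `Cruxes/H413/Lines/F0_U3CohMultOne.lean`, F0P3-plan (g0); F0P2-plan (g0) PLAN §5).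
PROOF FILE: theorems only — no definition, no instance, no notation, no named fact, no `sorry`; imports = ★ tree.
HONEST LABEL: HC_CM is proved only modulo the printed citations until rung 0 closes.

This is §4 of the junction: the sibling ★ `Theorems/H413SpectrumJunction.lean` proves the GENERIC statements over the Literature
carriers (A) ★ `UnitaryGroupCohomologicalForms` (`toQuotFun` calculus, `ContainsForm`, J3 `hasFinComponent_of_equivariant`,
J2-shape `∃`-introductions); here they are SPECIALISED to the crux carriers ★ `Theorems/H413CohFormsCarriers.lean`
(`adelicDatum F V`, `rightRep F V`, `conjFun F V`, `holCotForms 𝔞`, `cohForms 𝔞`, `𝔞 : ArchFactor F V`, e.g. `archFactorOf F V`):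
* the Summit carriers ARE the generic ones (`rightRep_eq_generic`, `conjFun_eq_generic`, `holCotForms_eq_generic`,
  `cohForms_eq_generic`, all `rfl` — F0-typ1 (g0)'s cert 46201227 recorded as theorems);
* `compactSpace_automorphicQuotient_adelicDatum`: `U(V)(F⁺)\U(V)(𝔸_{F⁺})` is COMPACT as soon as `4 ≤ [F:ℚ]` (`V` is positive
  definite at a complex place `≠` that of `ι₁`, `HermSpace3.posDef_of_ne`; ★ `compactSpace_cmDatum_automorphicQuotient_of_posDef`);
* members of `cohForms 𝔞` are left-`U(V)(F⁺)`-invariant; their continuous coordinates are in `L^p` of the quotient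
  (`memLp_toQuotFun_pin`); TRANSPORT `[ (R_g Φ)_j ] = R(1,g) [Φ_j]` (`toLp_toQuotFun_rightRep_pin`);
* J3 at the pin: `hasFinComponent_of_equivariant_pin` (values in `cohForms 𝔞`), `…_hol_pin` (in `holCotForms 𝔞`), `…_antihol_pin`
  (in `(holCotForms 𝔞).map conjFun`) — an IRREDUCIBLE `σ : Representation ℂ ↥(HermSpace3.adelicFin V) W` (the folds plug in the
  pin's `(datum413 …).rhoAt t` verbatim) with a non-zero `rightRep`-equivariant form-valued `ψ` whose values have continuous
  coordinates and are contained in the discrete automorphic `P` OCCURS in `P`: `P.HasFinComponent σ`;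
* J2 at the pin: `isHolCotangentAt_of_valued_pin` / `isAntiholCotangentAt_of_valued_pin`, the single-form versions
  `isHolCotangentAt_of_mem_pin` / `isAntiholCotangentAt_of_mem_pin`, and the unpackings `exists_mem_holCotForms_of_isHolCotangentAt_pin` /
  `exists_mem_map_conjFun_of_isAntiholCotangentAt_pin` (`P.IsHolCotangentAt 𝔞.ιinf 𝔞.Kc ↔ ∃` non-zero `Φ ∈ holCotForms 𝔞` contained in `P`).

CONTINUITY CAVEAT.  `holCotForms 𝔞` carries no continuity conjunct (★ `weightForms` is algebraic); continuity of coordinates is a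
hypothesis, supplied at the pin by programme P2's stub U2ℓ (`Represents`) through ★ `SpectrumJunction.continuous_of_continuous_descent`.

## References
* [BorelJacquet1979] A. Borel, H. Jacquet, *Automorphic forms and automorphic representations*, PSPM 33.1 (1979), §4.2, §4.6.
* [GelfandGraevPiatetskiShapiro1969] I. M. Gelfand, M. I. Graev, I. I. Piatetski-Shapiro, *Representation theory and automorphic
  functions* (1969), Ch. 1 §2.3.
* [BorelWallach2000] A. Borel, N. Wallach, *Continuous cohomology, discrete subgroups, and representations of reductive groups*,
  2nd ed. (2000), VII 3.2.
-/

set_option autoImplicit false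

-- the mandated namespace has the single-problem summit's repeated segment (`HodgeConjecture.HodgeConjecture`)
set_option linter.dupNamespace false

noncomputable section

namespace Summit.HodgeConjecture.HodgeConjecture.Cruxes.H413.SpectrumJunction

open MeasureTheory NumberField Topology
open scoped ENNReal
open Literature.NumberTheory.Automorphic Literature.NumberTheory.Automorphic.UnitaryGroup
open Literature.NumberTheory.Automorphic.UnitaryGroup.CotangentForms (toQuotFun toQuotFun_mk mem_holCotForms_iff)

/-! ## §4 At the pin `U(V)`: Summit carriers = generic carriers, compact quotient, and the pin corollaries -/

section Pin

open Summit.HodgeConjecture.HodgeConjecture.Cruxes.H413.CohFormsCarriers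

variable (F : HodgeCM.CMField) {ι₁ : F →+* ℂ} (V : HodgeCM.HermSpace3 F ι₁)

/-- The crux's right translation IS the generic one of (A) (`rfl`; F0-typ1 (g0) cert). [cite: BorelJacquet1979, §4.2] -/
theorem rightRep_eq_generic : rightRep F V = CotangentForms.rightRep (↥(maximalRealSubfield (HodgeCM.CMField.K F)))
    (HodgeCM.CMField.K F) (IsCMField.complexConj (HodgeCM.CMField.K F)) 3 (HodgeCM.HermSpace3.Hm V) := rfl

/-- The crux's conjugation IS the generic one of (A) (`rfl`). [cite: BorelWallach2000, VII 3.2] -/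
theorem conjFun_eq_generic : conjFun F V = CotangentForms.conjFun (↥(maximalRealSubfield (HodgeCM.CMField.K F)))
    (HodgeCM.CMField.K F) (IsCMField.complexConj (HodgeCM.CMField.K F)) 3 (HodgeCM.HermSpace3.Hm V) := rfl

variable {F V} in
/-- The crux's holomorphic cotangent forms for `𝔞` ARE the generic ones at `(𝔞.ιinf, 𝔞.Kc)` (`rfl`). [cite: BorelWallach2000, VII 3.2] -/
theorem holCotForms_eq_generic (𝔞 : ArchFactor F V) : holCotForms 𝔞 =
    CotangentForms.holCotForms (↥(maximalRealSubfield (HodgeCM.CMField.K F))) (HodgeCM.CMField.K F)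
      (IsCMField.complexConj (HodgeCM.CMField.K F)) 3 (HodgeCM.HermSpace3.Hm V) 𝔞.ιinf 𝔞.Kc := rfl

variable {F V} in
/-- The crux's cohomological cotangent forms for `𝔞` ARE the generic ones at `(𝔞.ιinf, 𝔞.Kc)` (`rfl`). [cite: BorelWallach2000, VII 3.2] -/
theorem cohForms_eq_generic (𝔞 : ArchFactor F V) : cohForms 𝔞 =
    CotangentForms.cohForms (↥(maximalRealSubfield (HodgeCM.CMField.K F))) (HodgeCM.CMField.K F)
      (IsCMField.complexConj (HodgeCM.CMField.K F)) 3 (HodgeCM.HermSpace3.Hm V) 𝔞.ιinf 𝔞.Kc := rfl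

/-- **The automorphic quotient `U(V)(F⁺)\U(V)(𝔸_{F⁺})` of the pin's group is COMPACT**: for `4 ≤ [F:ℚ]` there is a complex place
`≠` that of `ι₁` (★ `exists_infinitePlace_ne`), at which `V` is positive definite (`HermSpace3.posDef_of_ne`), so `Hm V` is
anisotropic and Godement's criterion applies (★ `compactSpace_cmDatum_automorphicQuotient_of_posDef`).
[cite: GelfandGraevPiatetskiShapiro1969, Ch. 1 §2.3] -/
theorem compactSpace_automorphicQuotient_adelicDatum (h4 : 4 ≤ Module.finrank ℚ F) :
    CompactSpace (adelicDatum F V).automorphicQuotient := by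
  obtain ⟨τ, hτ⟩ := UnitaryGroup.exists_infinitePlace_ne (HodgeCM.CMField.K F) h4 ι₁
  exact UnitaryGroup.compactSpace_cmDatum_automorphicQuotient_of_posDef (HodgeCM.CMField.K F) 3
    (HodgeCM.HermSpace3.Hm V) τ (V.posDef_of_ne τ hτ)

variable {F V}

/-- Members of `cohForms 𝔞` are left-`U(V)(F⁺)`-invariant (pin spelling of `leftInvariant_of_mem_cohForms`).
[cite: BorelJacquet1979, §4.2] -/
theorem leftInvariant_of_mem_cohForms_pin {𝔞 : ArchFactor F V} {Φ : (adelicDatum F V).Adelic → (Fin 2 → ℂ)}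
    (hΦ : Φ ∈ cohForms 𝔞) : ∀ γ ∈ (adelicDatum F V).quotientSubgroup, ∀ g, Φ (γ * g) = Φ g :=
  leftInvariant_of_mem_cohForms ((cohForms_eq_generic 𝔞) ▸ hΦ)

/-- **J3 AT THE PIN.**  For `4 ≤ [F:ℚ]`, an automorphic measure `μ` on `U(V)(F⁺)\U(V)(𝔸_{F⁺})`, a discrete automorphic `P`, an
IRREDUCIBLE representation `σ` of `U(V)(𝔸_{F⁺,f}) = ↥V.adelicFin` (e.g. the pin's `ω_V(t)`), and a NON-ZERO linear
`ψ : σ → (U(V)(𝔸_{F⁺}) → ℂ²)`, `rightRep`-equivariant, valued in `cohForms 𝔞` with continuous coordinates and contained in `P`: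
`P.HasFinComponent σ`. [cite: BorelJacquet1979, §4.6] -/
theorem hasFinComponent_of_equivariant_pin (h4 : 4 ≤ Module.finrank ℚ F)
    {μ : Measure (adelicDatum F V).automorphicQuotient} [(adelicDatum F V).IsAutomorphicMeasure μ]
    (P : DiscreteAutomorphicRep (adelicDatum F V) μ) {𝔞 : ArchFactor F V}
    {W : Type} [AddCommGroup W] [Module ℂ W] (σ : Representation ℂ ↥(HodgeCM.HermSpace3.adelicFin V) W)
    (hσ : σ.IsIrreducible) (ψ : W →ₗ[ℂ] ((adelicDatum F V).Adelic → (Fin 2 → ℂ)))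
    (hψ : ∀ (g : ↥(HodgeCM.HermSpace3.adelicFin V)) (w : W), ψ (σ g w) = rightRep F V g (ψ w))
    (hvals : ∀ w, ψ w ∈ cohForms 𝔞) (hcont : ∀ (w : W) (j : Fin 2), Continuous fun x => ψ w x j)
    (hP : ∀ w, P.ContainsForm (ψ w)) (hne : ψ ≠ 0) : P.HasFinComponent σ := by
  haveI := compactSpace_automorphicQuotient_adelicDatum F V h4
  exact hasFinComponent_of_equivariant P σ hσ ψ hψ (fun w => leftInvariant_of_mem_cohForms_pin (hvals w)) hcont hP hne

/-- **J2-shape AT THE PIN, type `(1,0)`**: a NON-ZERO map valued in `holCotForms 𝔞` and contained in `P` makes `P`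
H¹-cohomological of Hodge type `(1,0)` at `(𝔞.ιinf, 𝔞.Kc)`. [cite: BorelWallach2000, VII 3.2] -/
theorem isHolCotangentAt_of_valued_pin {μ : Measure (adelicDatum F V).automorphicQuotient}
    [SMulInvariantMeasure (adelicDatum F V).Adelic (adelicDatum F V).automorphicQuotient μ]
    (P : DiscreteAutomorphicRep (adelicDatum F V) μ) {𝔞 : ArchFactor F V} {W : Type}
    (ψ : W → ((adelicDatum F V).Adelic → (Fin 2 → ℂ))) (hvals : ∀ w, ψ w ∈ holCotForms 𝔞)
    (hP : ∀ w, P.ContainsForm (ψ w)) {w : W} (hw : ψ w ≠ 0) : P.IsHolCotangentAt 𝔞.ιinf 𝔞.Kc :=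
  isHolCotangentAt_of_valued P ψ (fun w => (holCotForms_eq_generic 𝔞) ▸ hvals w) hP hw

/-- **J2-shape AT THE PIN, type `(0,1)`**: the same with values in `(holCotForms 𝔞).map conjFun`. [cite: BorelWallach2000, VII 3.2] -/
theorem isAntiholCotangentAt_of_valued_pin {μ : Measure (adelicDatum F V).automorphicQuotient}
    [SMulInvariantMeasure (adelicDatum F V).Adelic (adelicDatum F V).automorphicQuotient μ]
    (P : DiscreteAutomorphicRep (adelicDatum F V) μ) {𝔞 : ArchFactor F V} {W : Type}
    (ψ : W → ((adelicDatum F V).Adelic → (Fin 2 → ℂ))) (hvals : ∀ w, ψ w ∈ (holCotForms 𝔞).map (conjFun F V))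
    (hP : ∀ w, P.ContainsForm (ψ w)) {w : W} (hw : ψ w ≠ 0) : P.IsAntiholCotangentAt 𝔞.ιinf 𝔞.Kc :=
  isAntiholCotangentAt_of_valued P ψ (fun w => (holCotForms_eq_generic 𝔞) ▸ (conjFun_eq_generic F V) ▸ hvals w) hP hw

/-- **A linear `ψ ≠ 0` has a non-zero value** (bookkeeping for the J2-shape lemmas, which take `ψ w ≠ 0`). [folklore] -/
theorem exists_apply_ne_zero_of_ne_zero {W X : Type} [AddCommGroup W] [Module ℂ W] [AddCommGroup X] [Module ℂ X]
    {ψ : W →ₗ[ℂ] X} (hne : ψ ≠ 0) : ∃ w, ψ w ≠ 0 := by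
  by_contra h
  push Not at h
  exact hne (LinearMap.ext fun w => h w)

/-- **J3 AT THE PIN, holomorphic values** (the shape stubs S3 / S5 of `F0_U3CohMultOne` feed): as
`hasFinComponent_of_equivariant_pin` with `ψ` valued in `holCotForms 𝔞 ≤ cohForms 𝔞`. [cite: BorelJacquet1979, §4.6] -/
theorem hasFinComponent_of_equivariant_hol_pin (h4 : 4 ≤ Module.finrank ℚ F)
    {μ : Measure (adelicDatum F V).automorphicQuotient} [(adelicDatum F V).IsAutomorphicMeasure μ]
    (P : DiscreteAutomorphicRep (adelicDatum F V) μ) {𝔞 : ArchFactor F V}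
    {W : Type} [AddCommGroup W] [Module ℂ W] (σ : Representation ℂ ↥(HodgeCM.HermSpace3.adelicFin V) W)
    (hσ : σ.IsIrreducible) (ψ : W →ₗ[ℂ] ((adelicDatum F V).Adelic → (Fin 2 → ℂ)))
    (hψ : ∀ (g : ↥(HodgeCM.HermSpace3.adelicFin V)) (w : W), ψ (σ g w) = rightRep F V g (ψ w))
    (hvals : ∀ w, ψ w ∈ holCotForms 𝔞) (hcont : ∀ (w : W) (j : Fin 2), Continuous fun x => ψ w x j)
    (hP : ∀ w, P.ContainsForm (ψ w)) (hne : ψ ≠ 0) : P.HasFinComponent σ :=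
  hasFinComponent_of_equivariant_pin h4 P σ hσ ψ hψ (fun w => Submodule.mem_sup_left (hvals w)) hcont hP hne

/-- **J3 AT THE PIN, antiholomorphic values** (the shape stubs S4 / S5 feed): as `hasFinComponent_of_equivariant_pin` with `ψ`
valued in `(holCotForms 𝔞).map conjFun ≤ cohForms 𝔞`. [cite: BorelJacquet1979, §4.6] -/
theorem hasFinComponent_of_equivariant_antihol_pin (h4 : 4 ≤ Module.finrank ℚ F)
    {μ : Measure (adelicDatum F V).automorphicQuotient} [(adelicDatum F V).IsAutomorphicMeasure μ]
    (P : DiscreteAutomorphicRep (adelicDatum F V) μ) {𝔞 : ArchFactor F V}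
    {W : Type} [AddCommGroup W] [Module ℂ W] (σ : Representation ℂ ↥(HodgeCM.HermSpace3.adelicFin V) W)
    (hσ : σ.IsIrreducible) (ψ : W →ₗ[ℂ] ((adelicDatum F V).Adelic → (Fin 2 → ℂ)))
    (hψ : ∀ (g : ↥(HodgeCM.HermSpace3.adelicFin V)) (w : W), ψ (σ g w) = rightRep F V g (ψ w))
    (hvals : ∀ w, ψ w ∈ (holCotForms 𝔞).map (conjFun F V)) (hcont : ∀ (w : W) (j : Fin 2), Continuous fun x => ψ w x j)
    (hP : ∀ w, P.ContainsForm (ψ w)) (hne : ψ ≠ 0) : P.HasFinComponent σ :=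
  hasFinComponent_of_equivariant_pin h4 P σ hσ ψ hψ (fun w => Submodule.mem_sup_right (hvals w)) hcont hP hne

/-- **J2 AT THE PIN, single form, type `(1,0)`**: a non-zero `Φ ∈ holCotForms 𝔞` contained in `P` gives `P.IsHolCotangentAt 𝔞.ιinf 𝔞.Kc`.
[cite: BorelWallach2000, VII 3.2] -/
theorem isHolCotangentAt_of_mem_pin {μ : Measure (adelicDatum F V).automorphicQuotient}
    [SMulInvariantMeasure (adelicDatum F V).Adelic (adelicDatum F V).automorphicQuotient μ]
    (P : DiscreteAutomorphicRep (adelicDatum F V) μ) {𝔞 : ArchFactor F V} {Φ : (adelicDatum F V).Adelic → (Fin 2 → ℂ)}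
    (hΦ : Φ ∈ holCotForms 𝔞) (hne : Φ ≠ 0) (hP : P.ContainsForm Φ) : P.IsHolCotangentAt 𝔞.ιinf 𝔞.Kc :=
  ⟨Φ, (holCotForms_eq_generic 𝔞) ▸ hΦ, hne, hP⟩

/-- **J2 AT THE PIN, single form, type `(0,1)`**: a non-zero `Φ ∈ (holCotForms 𝔞).map conjFun` contained in `P` gives
`P.IsAntiholCotangentAt 𝔞.ιinf 𝔞.Kc`. [cite: BorelWallach2000, VII 3.2] -/
theorem isAntiholCotangentAt_of_mem_pin {μ : Measure (adelicDatum F V).automorphicQuotient}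
    [SMulInvariantMeasure (adelicDatum F V).Adelic (adelicDatum F V).automorphicQuotient μ]
    (P : DiscreteAutomorphicRep (adelicDatum F V) μ) {𝔞 : ArchFactor F V} {Φ : (adelicDatum F V).Adelic → (Fin 2 → ℂ)}
    (hΦ : Φ ∈ (holCotForms 𝔞).map (conjFun F V)) (hne : Φ ≠ 0) (hP : P.ContainsForm Φ) :
    P.IsAntiholCotangentAt 𝔞.ιinf 𝔞.Kc :=
  ⟨Φ, (holCotForms_eq_generic 𝔞) ▸ (conjFun_eq_generic F V) ▸ hΦ, hne, hP⟩

/-- **J2 AT THE PIN, unpacking, type `(1,0)`**: `P.IsHolCotangentAt 𝔞.ιinf 𝔞.Kc` yields a non-zero `Φ ∈ holCotForms 𝔞` (Summit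
carrier) contained in `P`. [cite: BorelWallach2000, VII 3.2] -/
theorem exists_mem_holCotForms_of_isHolCotangentAt_pin {μ : Measure (adelicDatum F V).automorphicQuotient}
    [SMulInvariantMeasure (adelicDatum F V).Adelic (adelicDatum F V).automorphicQuotient μ]
    (P : DiscreteAutomorphicRep (adelicDatum F V) μ) {𝔞 : ArchFactor F V} (hP : P.IsHolCotangentAt 𝔞.ιinf 𝔞.Kc) :
    ∃ Φ ∈ holCotForms 𝔞, Φ ≠ 0 ∧ P.ContainsForm Φ := by
  obtain ⟨Φ, hΦ, hne, hc⟩ := hP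
  exact ⟨Φ, (holCotForms_eq_generic 𝔞).symm ▸ hΦ, hne, hc⟩

/-- **J2 AT THE PIN, unpacking, type `(0,1)`**: `P.IsAntiholCotangentAt 𝔞.ιinf 𝔞.Kc` yields a non-zero
`Φ ∈ (holCotForms 𝔞).map conjFun` contained in `P`. [cite: BorelWallach2000, VII 3.2] -/
theorem exists_mem_map_conjFun_of_isAntiholCotangentAt_pin {μ : Measure (adelicDatum F V).automorphicQuotient}
    [SMulInvariantMeasure (adelicDatum F V).Adelic (adelicDatum F V).automorphicQuotient μ]
    (P : DiscreteAutomorphicRep (adelicDatum F V) μ) {𝔞 : ArchFactor F V} (hP : P.IsAntiholCotangentAt 𝔞.ιinf 𝔞.Kc) :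
    ∃ Φ ∈ (holCotForms 𝔞).map (conjFun F V), Φ ≠ 0 ∧ P.ContainsForm Φ := by
  obtain ⟨Φ, hΦ, hne, hc⟩ := hP
  exact ⟨Φ, (holCotForms_eq_generic 𝔞).symm ▸ (conjFun_eq_generic F V).symm ▸ hΦ, hne, hc⟩

/-- **TRANSPORT AT THE PIN** (junction (i) in the crux's spelling; programme P2's «`ℓ (R_g f) k = R(1,g) (ℓ f k)`»): for a
left-`U(V)(F⁺)`-invariant `Φ` and `g ∈ U(V)(𝔸_{F⁺,f})`, the `L²`-class of the coordinate `j` of `rightRep F V g Φ` is the regular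
representation at `(1, g)` applied to the class of the coordinate `j` of `Φ`. [cite: BorelJacquet1979, §4.6] -/
theorem toLp_toQuotFun_rightRep_pin {μ : Measure (adelicDatum F V).automorphicQuotient}
    [SMulInvariantMeasure (adelicDatum F V).Adelic (adelicDatum F V).automorphicQuotient μ]
    {Φ : (adelicDatum F V).Adelic → (Fin 2 → ℂ)} (hΦ : ∀ γ ∈ (adelicDatum F V).quotientSubgroup, ∀ x, Φ (γ * x) = Φ x)
    (g : ↥(HodgeCM.HermSpace3.adelicFin V)) (j : Fin 2)
    (hmem : MemLp (toQuotFun (adelicDatum F V) fun x => Φ x j) 2 μ)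
    (hmemg : MemLp (toQuotFun (adelicDatum F V) fun x => rightRep F V g Φ x j) 2 μ) :
    hmemg.toLp (toQuotFun (adelicDatum F V) fun x => rightRep F V g Φ x j) =
      (adelicDatum F V).rightRegular μ (finToAdelic F V g) (hmem.toLp (toQuotFun (adelicDatum F V) fun x => Φ x j)) :=
  toLp_toQuotFun_mul_right (Φ := fun y => Φ y j) (fun γ hγ x => by simp only [hΦ γ hγ x]) (finToAdelic F V g) hmem hmemg

/-- **`L²`-membership of cotangent-form coordinates AT THE PIN**: for `4 ≤ [F:ℚ]` and a finite measure, every coordinate of a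
member of `cohForms 𝔞` with continuous coordinates is in `L^p` of the (compact) automorphic quotient, every `p`.
[cite: GelfandGraevPiatetskiShapiro1969, Ch. 1 §2.3] -/
theorem memLp_toQuotFun_pin (h4 : 4 ≤ Module.finrank ℚ F) {μ : Measure (adelicDatum F V).automorphicQuotient}
    [IsFiniteMeasure μ] {𝔞 : ArchFactor F V} {Φ : (adelicDatum F V).Adelic → (Fin 2 → ℂ)} (hΦ : Φ ∈ cohForms 𝔞)
    (j : Fin 2) (hcont : Continuous fun x => Φ x j) (p : ℝ≥0∞) :
    MemLp (toQuotFun (adelicDatum F V) fun x => Φ x j) p μ := by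
  haveI := compactSpace_automorphicQuotient_adelicDatum F V h4
  exact memLp_toQuotFun (fun γ hγ x => by simp only [leftInvariant_of_mem_cohForms_pin hΦ γ hγ x]) hcont p

end Pin

end Summit.HodgeConjecture.HodgeConjecture.Cruxes.H413.SpectrumJunction

end
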